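import Summits.RiemannHypothesis.RiemannHypothesis.Theses.WeilComb
import Summits.RiemannHypothesis.RiemannHypothesis.Theorems.WeilCombCombShapeAdmissible
import Summits.RiemannHypothesis.RiemannHypothesis.Theorems.WeilCombCombShapePositivityPoleCoefficient
import Literature.NumberTheory.LFunctions.WeilExplicit
import Literature.NumberTheory.LFunctions.WeilMellinBounds
import Literature.NumberTheory.LFunctions.WeilArchimedeanMoments
import Literature.NumberTheory.LFunctions.WeilArchimedeanPositivityProofs
import Literature.NumberTheory.LFunctions.WeilSmallSupportPositivity
import Literature.Analysis.SpecialFunctions.DigammaVerticalSeries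

/-!
# Sharp archimedean diagonal coercivity for narrow Weil tests (constant `5/2`)
(helper for stub `stub_subDiagPole` of line `Sketch`, crux `WeilComb.CombShapePositivity`,
item stmt-RiemannHypothesis-11229, route route-RiemannHypothesis-WeilComb)

This file proves the general estimate `re_weilArchTerm_autocorr_ge_sharp` (part (a) below for an arbitrary
narrow Weil test); the stub itself (specialisation to `φ_ε` plus the pole coefficients (b) and Cauchy–Schwarz (c))
is assembled in `WeilCombCombShapePositivityStubSubDiagPole.lean`. The three analytic constants of the fixed bump
are consumed by the effective subcritical window (`stub_windowSub` / `assemble_sub` of the skeleton). Notation: `φ₀(u) = expNegInvGlue (1 - u²)`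
(a Weil test supported in `[-1, 1]`, `weilComb_shapeBump_isWeilTest`,
`weilComb_shapeBump_tsupport_subset`), `φ_ε(t) = ε⁻¹ φ₀(t/ε)`, `ψ_ε = φ_ε ⋆ φ̃_ε`
(`weilConv`/`weilReflect`), `ĥ = weilMellin h`, `W_∞ = weilArchTerm`, `N = ‖φ₀‖₂²` (`weilNorm2Sq`),
`I₀ = ∫ φ₀`, `ρ(u) = Re ψ(1/4 + iu/2)` (`reDigammaQuarter`).

* (a) **Sharp archimedean diagonal.** For `0 < ε ≤ 1/4`,
  `Re W_∞(ψ_ε) ≥ ε⁻¹ N (log(1/ε) − 5/2) − N (9 + 3 log(1/ε))`.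
  This is the case `g = φ_ε`, `b = ε` of the general estimate
  `re_weilArchTerm_autocorr_ge_sharp`: for a Weil test `g` with `tsupport g ⊆ [-b, b]`,
  `0 < b ≤ 1/4`, `Re W_∞(g ⋆ g̃) ≥ (log(1/b) − 5/2 − b(9 + 3 log(1/b))) ‖g‖₂²`.
  Proof: `Re W_∞(g ⋆ g̃) = (1/2π) ∫ G ρ − (log π) ‖g‖₂²`, `G(u) = |ĝ(1/2+iu)|²`
  (`weilArchIntegral_weilConv_weilReflect`, `weilConv_weilReflect_apply_zero`), with
  `0 ≤ G ≤ L²`, `L = ‖g‖₁`, `∫ G = 2π ‖g‖₂²` (Plancherel), `L² ≤ 2b ‖g‖₂²`. The weight has the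
  three-regime minorant (`weilLevel_le_reDigammaQuarter`, `ρ ≥ ρ(0) ≥ −4.22745354`):
  `ρ(u) ≥ κ := L_{1/b} = log(1/(2b)) − 2b² − πb/2` for `|u| ≥ 1/b`,
  `ρ(u) ≥ L_{|u|} ≥ log|u| − log 2 − (1 + π/2)/|u|` for `2 ≤ |u|`, `ρ ≥ −4.22745354` always; hence
  POINTWISE `κ G − L² k ≤ G ρ` with the explicit error weight
  `k = 1_{(-1/b,1/b]} (log(1/b) − log|u|) + 4.22745354·1_{(-2,2]} + (1+π/2) (1_{(2,1/b]} − 1_{(-1/b,-2]}) u⁻¹ ≥ 0`,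
  whose integral is `2/b + 16.90981416 + (2 + π)(log(1/b) − log 2)` (`integral_log`,
  `integral_inv_of_pos/neg`). Integrating and using `L² ≤ 2b‖g‖₂²`,
  `log 2 + 2/π + log π < 5/2` (`Real.log_two_lt_d9`, `Real.pi_gt_d2`, `Real.log_pi_le`) gives the
  claim; the `b`-terms are absorbed by `b(9 + 3 log(1/b))`.
* (b) **Pole coefficients.** `‖φ̂_ε(0)‖, ‖φ̂_ε(1)‖ ≤ e^{ε/2} I₀`: both equal the `cosh`-moment
  `∫ φ₀(u) cosh(εu/2) du > 0` (`weilMellin_dilBump_zero_one`, p92438) and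
  `cosh(εu/2) ≤ e^{ε/2}` on the support `|u| ≤ 1`.
* (c) **Cauchy–Schwarz.** `I₀² ≤ 2N` (`weilNorm1_sq_le` with `a = 1`; `weilNorm1 φ₀ = I₀` as
  `φ₀ ≥ 0`).
-/

noncomputable section

-- the sub-problem path RiemannHypothesis/RiemannHypothesis duplicates a namespace (D-0017)
set_option linter.dupNamespace false

open scoped BigOperators ComplexConjugate
open Complex MeasureTheory Set

namespace Summit.RiemannHypothesis.RiemannHypothesis.Theorems.WeilCombBohrFejer

open Literature.NumberTheory.LFunctions

/-! ### The four pieces of the error weight `k`: integrability and integrals -/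

/-- `∫ 1_{(-1/b, 1/b]}(u) (log(1/b) − log|u|) du = 2/b` (`integral_log`; `b > 0`). [folklore] -/
private theorem integral_logPiece {b : ℝ} (hb : 0 < b) :
    Integrable ((Ioc (-(1 / b)) (1 / b)).indicator fun u : ℝ ↦ Real.log (1 / b) - Real.log |u|) ∧
    ∫ u, (Ioc (-(1 / b)) (1 / b)).indicator (fun u : ℝ ↦ Real.log (1 / b) - Real.log |u|) u =
      2 / b := by
  -- adapted from `WeilCombSubcritical.stub_archDiag` (the computation of `∫ ℓ = 2/b` there)
  have hb' : 0 < 1 / b := one_div_pos.2 hb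
  have hab : -(1 / b) ≤ 1 / b := by linarith
  have hlogi : IntervalIntegrable (fun u ↦ Real.log (1 / b) - Real.log |u|) volume
      (-(1 / b)) (1 / b) := by
    simp_rw [Real.log_abs]
    exact intervalIntegrable_const.sub intervalIntegral.intervalIntegrable_log'
  refine ⟨hlogi.1.integrable_indicator measurableSet_Ioc, ?_⟩
  have hIval : ∫ u in (-(1 / b))..(1 / b), (Real.log (1 / b) - Real.log |u|) = 2 / b := by
    simp_rw [Real.log_abs]
    rw [intervalIntegral.integral_sub intervalIntegrable_const
      intervalIntegral.intervalIntegrable_log', intervalIntegral.integral_const, integral_log,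
      smul_eq_mul, Real.log_neg_eq_log]
    ring
  rw [integral_indicator measurableSet_Ioc, ← intervalIntegral.integral_of_le hab, hIval]

/-- `∫ 4.22745354 · 1_{(-2, 2]} = 16.90981416`. [folklore] -/
private theorem integral_constPiece :
    Integrable ((Ioc (-2 : ℝ) 2).indicator fun _ : ℝ ↦ (4.22745354 : ℝ)) ∧
    ∫ u, (Ioc (-2 : ℝ) 2).indicator (fun _ : ℝ ↦ (4.22745354 : ℝ)) u = 16.90981416 := by
  have hi : IntervalIntegrable (fun _ : ℝ ↦ (4.22745354 : ℝ)) volume (-2) 2 :=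
    intervalIntegrable_const
  refine ⟨hi.1.integrable_indicator measurableSet_Ioc, ?_⟩
  rw [integral_indicator measurableSet_Ioc,
    ← intervalIntegral.integral_of_le (by norm_num : (-2 : ℝ) ≤ 2),
    intervalIntegral.integral_const, smul_eq_mul]
  norm_num

/-- `∫ 1_{(2, 1/b]}(u) q u⁻¹ du = q (log(1/b) − log 2)` (`integral_inv_of_pos`; `0 < b ≤ 1/4`).
[folklore] -/
private theorem integral_posPiece {b : ℝ} (hb : 0 < b) (hb4 : b ≤ 1 / 4) (q : ℝ) :
    Integrable ((Ioc (2 : ℝ) (1 / b)).indicator fun u : ℝ ↦ q * u⁻¹) ∧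
    ∫ u, (Ioc (2 : ℝ) (1 / b)).indicator (fun u : ℝ ↦ q * u⁻¹) u =
      q * (Real.log (1 / b) - Real.log 2) := by
  have hb' : 0 < 1 / b := one_div_pos.2 hb
  have h2b : (2 : ℝ) ≤ 1 / b := by rw [le_div_iff₀ hb]; linarith
  have hne : ∀ x : ℝ, x ∈ uIcc (2 : ℝ) (1 / b) → x ≠ 0 := by
    intro x hx
    rw [uIcc_of_le h2b] at hx
    exact (lt_of_lt_of_le two_pos hx.1).ne'
  have hi : IntervalIntegrable (fun u : ℝ ↦ q * u⁻¹) volume 2 (1 / b) :=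
    (intervalIntegral.intervalIntegrable_inv hne continuousOn_id).const_mul q
  refine ⟨hi.1.integrable_indicator measurableSet_Ioc, ?_⟩
  rw [integral_indicator measurableSet_Ioc, ← intervalIntegral.integral_of_le h2b,
    intervalIntegral.integral_const_mul, integral_inv_of_pos two_pos hb',
    Real.log_div hb'.ne' two_ne_zero]

/-- `∫ 1_{(-1/b, -2]}(u) (−q u⁻¹) du = q (log(1/b) − log 2)` (`integral_inv_of_neg`;
`0 < b ≤ 1/4`). [folklore] -/
private theorem integral_negPiece {b : ℝ} (hb : 0 < b) (hb4 : b ≤ 1 / 4) (q : ℝ) :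
    Integrable ((Ioc (-(1 / b)) (-2 : ℝ)).indicator fun u : ℝ ↦ -(q * u⁻¹)) ∧
    ∫ u, (Ioc (-(1 / b)) (-2 : ℝ)).indicator (fun u : ℝ ↦ -(q * u⁻¹)) u =
      q * (Real.log (1 / b) - Real.log 2) := by
  have hb' : 0 < 1 / b := one_div_pos.2 hb
  have h2b' : (2 : ℝ) ≤ 1 / b := by rw [le_div_iff₀ hb]; linarith
  have h2b : -(1 / b) ≤ (-2 : ℝ) := by linarith
  have hne : ∀ x : ℝ, x ∈ uIcc (-(1 / b)) (-2 : ℝ) → x ≠ 0 := by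
    intro x hx
    rw [uIcc_of_le h2b] at hx
    exact (lt_of_le_of_lt hx.2 (by norm_num)).ne
  have hi : IntervalIntegrable (fun u : ℝ ↦ -(q * u⁻¹)) volume (-(1 / b)) (-2) :=
    ((intervalIntegral.intervalIntegrable_inv hne continuousOn_id).const_mul q).neg
  refine ⟨hi.1.integrable_indicator measurableSet_Ioc, ?_⟩
  rw [integral_indicator measurableSet_Ioc, ← intervalIntegral.integral_of_le h2b,
    intervalIntegral.integral_neg, intervalIntegral.integral_const_mul,
    integral_inv_of_neg (by linarith) (by norm_num), neg_div_neg_eq,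
    Real.log_div two_ne_zero hb'.ne']
  ring

/-! ### The closing arithmetic -/

/-- The closing arithmetic of the sharp diagonal estimate: from
`A ≥ 2πκN − L²(2/b + 16.90981416 + (2+π)(c − log 2))`, `κ = c − log 2 − 2b² − πb/2`,
`L² ≤ 2bN`, `0 < b ≤ 1/4`, `c ≥ log 2`, deduce
`(c − 5/2)N − b(9 + 3c)N ≤ A/(2π) − N log π` (`log 2 + 2/π + log π < 5/2`). [folklore] -/
private theorem closing_arith {b c N κ A L : ℝ} (hb : 0 < b) (hb4 : b ≤ 1 / 4) (hN0 : 0 ≤ N)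
    (hc2 : Real.log 2 ≤ c) (hκc : κ = c - Real.log 2 - 2 * b ^ 2 - Real.pi * b / 2)
    (hL2 : L ^ 2 ≤ 2 * b * N)
    (hA : κ * (2 * Real.pi * N) -
        L ^ 2 * (2 / b + 16.90981416 + 2 * (1 + Real.pi / 2) * (c - Real.log 2)) ≤ A) :
    (c - 5 / 2) * N - b * (9 + 3 * c) * N ≤ 1 / (2 * Real.pi) * A - N * Real.log Real.pi := by
  have hl2 := Real.log_two_lt_d9
  have hl2' := Real.log_two_gt_d9
  have hlpi := Literature.Analysis.SpecialFunctions.Real.log_pi_le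
  have hpi := Real.pi_gt_d2
  have hpi' := Real.pi_lt_d2
  have hπ0 : 0 < Real.pi := Real.pi_pos
  have hpinv : Real.pi⁻¹ < 0.3185 := by
    have h := (inv_lt_inv₀ hπ0 (by norm_num : (0 : ℝ) < 3.14)).2 hpi
    have h2 : (3.14 : ℝ)⁻¹ < 0.3185 := by norm_num
    exact h.trans h2
  have hpinv0 : 0 < Real.pi⁻¹ := inv_pos.2 hπ0
  have hc0 : 0 ≤ c := by linarith
  have hl20 : 0 ≤ Real.log 2 := by linarith
  set K := 2 / b + 16.90981416 + 2 * (1 + Real.pi / 2) * (c - Real.log 2) with hK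
  have hK0 : 0 ≤ K := by
    have : 0 ≤ c - Real.log 2 := by linarith
    positivity
  have hLK : L ^ 2 * K ≤ 2 * b * N * K := mul_le_mul_of_nonneg_right hL2 hK0
  have hAge : κ * (2 * Real.pi * N) - 2 * b * N * K ≤ A := by linarith
  have h2π : 1 / (2 * Real.pi) * (κ * (2 * Real.pi * N) - 2 * b * N * K) ≤
      1 / (2 * Real.pi) * A := mul_le_mul_of_nonneg_left hAge (by positivity)
  have e : 1 / (2 * Real.pi) * (κ * (2 * Real.pi * N) - 2 * b * N * K) =
      (c - Real.log 2 - 2 * b ^ 2 - Real.pi * b / 2) * N - Real.pi⁻¹ * (2 * N) -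
        Real.pi⁻¹ * (16.90981416 * (b * N)) -
        (2 * Real.pi⁻¹ + 1) * (b * (c - Real.log 2) * N) := by
    rw [hK, hκc]
    field_simp
    ring
  rw [e] at h2π
  have hp1 : 0 ≤ (5 / 2 - Real.log 2 - 2 * Real.pi⁻¹ - Real.log Real.pi) * N :=
    mul_nonneg (by linarith) hN0
  have hp2 : 0 ≤ (9 - 2 * b - Real.pi / 2 - 16.90981416 * Real.pi⁻¹) * (b * N) :=
    mul_nonneg (by linarith) (mul_nonneg hb.le hN0)
  have hp3 : 0 ≤ (2 - 2 * Real.pi⁻¹) * (b * c * N) :=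
    mul_nonneg (by linarith) (mul_nonneg (mul_nonneg hb.le hc0) hN0)
  have hp4 : 0 ≤ (2 * Real.pi⁻¹ + 1) * (b * Real.log 2 * N) :=
    mul_nonneg (by linarith) (mul_nonneg (mul_nonneg hb.le hl20) hN0)
  linarith

/-! ### The sharp diagonal estimate for a general narrow Weil test -/

/-- **Sharp diagonal coercivity of the archimedean term.** For a Weil test `g` with
`tsupport g ⊆ [-b, b]`, `0 < b ≤ 1/4`:
`Re W_∞(g ⋆ g̃) ≥ (log(1/b) − 5/2) ‖g‖₂² − b (9 + 3 log(1/b)) ‖g‖₂²` (Bombieri 2000 §12-type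
estimate with the three-regime minorant of `Re ψ(1/4 + iu/2)`; see the module docstring). [folklore] -/
theorem re_weilArchTerm_autocorr_ge_sharp : ∀ {g : ℝ → ℂ}, IsWeilTest g → ∀ {b : ℝ}, 0 < b → b ≤ 1 / 4 →
    tsupport g ⊆ Set.Icc (-b) b →
    (Real.log (1 / b) - 5 / 2) * weilNorm2Sq g - b * (9 + 3 * Real.log (1 / b)) * weilNorm2Sq g ≤
      (weilArchTerm (weilConv g (weilReflect g))).re := by
  intro g hg b hb hb4 hsupp
  -- notation
  set N := weilNorm2Sq g with hN
  have hN0 : 0 ≤ N := weilNorm2Sq_nonneg g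
  set L := weilNorm1 g with hL
  set G : ℝ → ℝ := fun u ↦ ‖weilMellin g (1 / 2 + u * I)‖ ^ 2 with hG
  have hGi : Integrable G := integrable_norm_sq_weilMellin_half_line hg
  have hPl : ∫ u, G u = 2 * Real.pi * N := integral_norm_sq_weilMellin_half_line hg
  have hGL : ∀ u, G u ≤ L ^ 2 := fun u ↦
    pow_le_pow_left₀ (norm_nonneg _) (norm_weilMellin_half_line_le hg u) 2
  have hG0 : ∀ u, 0 ≤ G u := fun u ↦ by positivity
  set ρ : ℝ → ℝ := Literature.Analysis.SpecialFunctions.reDigammaQuarter with hρ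
  set A : ℝ := ∫ t : ℝ, ‖weilMellin g (1 / 2 + t * I)‖ ^ 2 *
    (Complex.digamma (1 / 4 + t / 2 * I)).re with hA
  -- Step 1: the archimedean term of `g ⋆ g̃` is `(1/2π) A − N log π`
  have harch : (weilArchTerm (weilConv g (weilReflect g))).re =
      1 / (2 * Real.pi) * A - N * Real.log Real.pi := by
    have e : weilArchTerm (weilConv g (weilReflect g)) =
        ((1 / (2 * Real.pi) * A - N * Real.log Real.pi : ℝ) : ℂ) := by
      unfold weilArchTerm
      rw [weilArchIntegral_weilConv_weilReflect hg, weilConv_weilReflect_apply_zero, ← hA,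
        show (∫ t : ℝ, ‖g t‖ ^ 2) = N from rfl]
      push_cast
      ring
    rw [e, Complex.ofReal_re]
  -- Step 2: constants and the pieces of the error weight `k`
  set q : ℝ := 1 + Real.pi / 2 with hq
  have hq0 : 0 ≤ q := by positivity
  obtain ⟨hi₀int, hi₀val⟩ := integral_logPiece hb
  obtain ⟨hi₁int, hi₁val⟩ := integral_constPiece
  obtain ⟨hipint, hipval⟩ := integral_posPiece hb hb4 q
  obtain ⟨himint, himval⟩ := integral_negPiece hb hb4 q
  set c := Real.log (1 / b) with hc
  have hb' : 0 < 1 / b := by positivity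
  have hb4' : 4 ≤ 1 / b := by rw [le_div_iff₀ hb]; linarith
  have hc2 : Real.log 2 ≤ c := Real.log_le_log two_pos (by linarith)
  set κ := weilLevel (1 / b) with hκ
  have hκc : κ = c - Real.log 2 - 2 * b ^ 2 - Real.pi * b / 2 := by
    rw [hκ, weilLevel, hc, Real.log_div hb'.ne' two_ne_zero]
    field_simp
  have hκle : κ ≤ c - Real.log 2 := by rw [hκc]; nlinarith [sq_nonneg b, Real.pi_pos]
  have hρ0 : ∀ u, (-4.22745354 : ℝ) ≤ ρ u := by
    intro u
    have h0 := Literature.Analysis.SpecialFunctions.re_digamma_one_quarter_ge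
    have h1 := Literature.Analysis.SpecialFunctions.reDigammaQuarter_zero_le u
    rw [Literature.Analysis.SpecialFunctions.reDigammaQuarter_zero] at h1
    simp only [hρ]
    linarith
  set S₀ : Set ℝ := Ioc (-(1 / b)) (1 / b) with hS₀
  set S₁ : Set ℝ := Ioc (-2 : ℝ) 2 with hS₁
  set Sp : Set ℝ := Ioc (2 : ℝ) (1 / b) with hSp
  set Sm : Set ℝ := Ioc (-(1 / b)) (-2 : ℝ) with hSm
  set i₀ : ℝ → ℝ := S₀.indicator (fun u ↦ c - Real.log |u|) with hi₀
  set i₁ : ℝ → ℝ := S₁.indicator (fun _ ↦ (4.22745354 : ℝ)) with hi₁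
  set ip : ℝ → ℝ := Sp.indicator (fun u ↦ q * u⁻¹) with hip
  set im : ℝ → ℝ := Sm.indicator (fun u ↦ -(q * u⁻¹)) with him
  set k : ℝ → ℝ := fun u ↦ i₀ u + i₁ u + ip u + im u with hk
  have hlogc : ∀ u, |u| ≤ 1 / b → Real.log |u| ≤ c := by
    intro u hu
    rcases eq_or_ne u 0 with rfl | hu0
    · rw [abs_zero, Real.log_zero]
      linarith [Real.log_nonneg one_le_two]
    · exact Real.log_le_log (abs_pos.2 hu0) hu
  have hi₀0 : ∀ u, 0 ≤ i₀ u := by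
    intro u
    refine Set.indicator_nonneg (fun v hv ↦ ?_) u
    have : |v| ≤ 1 / b := abs_le.2 ⟨hv.1.le, hv.2⟩
    linarith [hlogc v this]
  have hi₁0 : ∀ u, 0 ≤ i₁ u := fun u ↦ Set.indicator_nonneg (fun _ _ ↦ by norm_num) u
  have hip0 : ∀ u, 0 ≤ ip u := by
    intro u
    refine Set.indicator_nonneg (fun v hv ↦ ?_) u
    have : 0 < v := by linarith [hv.1]
    positivity
  have him0 : ∀ u, 0 ≤ im u := by
    intro u
    refine Set.indicator_nonneg (fun v hv ↦ ?_) u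
    have hv0 : v < 0 := by linarith [hv.2]
    have : v⁻¹ < 0 := inv_lt_zero.2 hv0
    nlinarith
  have hk0 : ∀ u, 0 ≤ k u := fun u ↦ by
    simp only [hk]; linarith [hi₀0 u, hi₁0 u, hip0 u, him0 u]
  -- Step 3: the pointwise minorant `h = κ G − L² k ≤ G ρ`
  set h : ℝ → ℝ := fun u ↦ κ * G u - L ^ 2 * k u with hh
  have hpt : ∀ u, h u ≤ G u * ρ u := by
    intro u
    have hL2G : G u ≤ L ^ 2 := hGL u
    rcases le_or_gt (1 / b) |u| with hu | hu
    · -- `|u| ≥ 1/b`: `ρ u ≥ κ` and `k u ≥ 0`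
      have hρu : κ ≤ ρ u := weilLevel_le_reDigammaQuarter (by linarith) hu
      have h1 : κ * G u ≤ ρ u * G u := mul_le_mul_of_nonneg_right hρu (hG0 u)
      rw [mul_comm (ρ u)] at h1
      have h2 : 0 ≤ L ^ 2 * k u := mul_nonneg (sq_nonneg L) (hk0 u)
      simp only [hh]
      linarith
    · by_cases hu1 : u ∈ S₁
      · -- `-2 < u ≤ 2`: `ρ u ≥ ψ₀` and `k u ≥ (c − log 2) + 4.22745354`
        have hv1 : i₁ u = 4.22745354 := by simp only [hi₁]; exact indicator_of_mem hu1 _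
        have hu0 : u ∈ S₀ := ⟨by linarith [hu1.1], by linarith [hu1.2]⟩
        have hv0 : i₀ u = c - Real.log |u| := by simp only [hi₀]; exact indicator_of_mem hu0 _
        have hlog2 : Real.log |u| ≤ Real.log 2 := by
          rcases eq_or_ne u 0 with rfl | hu0'
          · rw [abs_zero, Real.log_zero]
            exact Real.log_nonneg one_le_two
          · exact Real.log_le_log (abs_pos.2 hu0') (abs_le.2 ⟨hu1.1.le, hu1.2⟩)
        have hku : c - Real.log 2 + 4.22745354 ≤ k u := by
          have := hip0 u
          have := him0 u
          simp only [hk]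
          rw [hv0, hv1]
          linarith
        have h1 : κ * G u ≤ (c - Real.log 2) * L ^ 2 :=
          (mul_le_mul_of_nonneg_right hκle (hG0 u)).trans
            (mul_le_mul_of_nonneg_left hL2G (by linarith))
        have h2 : G u * (-4.22745354) ≤ G u * ρ u := mul_le_mul_of_nonneg_left (hρ0 u) (hG0 u)
        have h3 : L ^ 2 * (c - Real.log 2 + 4.22745354) ≤ L ^ 2 * k u :=
          mul_le_mul_of_nonneg_left hku (sq_nonneg L)
        simp only [hh]
        linarith
      · -- `2 ≤ |u| < 1/b`: `ρ u ≥ weilLevel |u|`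
        have hu2 : 2 ≤ |u| := by
          simp only [hS₁, mem_Ioc, not_and_or, not_lt, not_le] at hu1
          rcases hu1 with h | h
          · rw [abs_of_nonpos (by linarith)]
            linarith
          · exact h.le.trans (le_abs_self u)
        have hupos : 0 < |u| := by linarith
        have hρu : weilLevel |u| ≤ ρ u := weilLevel_le_reDigammaQuarter hu2 le_rfl
        have hu0 : u ∈ S₀ := ⟨(abs_lt.1 hu).1, (abs_lt.1 hu).2.le⟩
        have hv0 : i₀ u = c - Real.log |u| := by simp only [hi₀]; exact indicator_of_mem hu0 _
        have hpm : q * |u|⁻¹ ≤ ip u + im u := by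
          rcases lt_or_ge 0 u with hup | hun
          · have hau : |u| = u := abs_of_pos hup
            rw [hau] at hu hu2
            have hmem : u ∈ Sp :=
              ⟨lt_of_le_of_ne hu2 fun h ↦ hu1 (h ▸ ⟨by norm_num, le_rfl⟩), hu.le⟩
            have e : ip u = q * u⁻¹ := by simp only [hip]; exact indicator_of_mem hmem _
            calc q * |u|⁻¹ = ip u := by rw [hau, e]
              _ ≤ ip u + im u := le_add_of_nonneg_right (him0 u)
          · have hau : |u| = -u := abs_of_nonpos hun
            rw [hau] at hu hu2
            have hmem : u ∈ Sm := ⟨by linarith, by linarith⟩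
            have e : im u = -(q * u⁻¹) := by simp only [him]; exact indicator_of_mem hmem _
            calc q * |u|⁻¹ = im u := by rw [hau, e, inv_neg, mul_neg]
              _ ≤ ip u + im u := le_add_of_nonneg_left (hip0 u)
        have hku : (c - Real.log |u|) + q * |u|⁻¹ ≤ k u := by
          simp only [hk]
          rw [hv0]
          linarith [hi₁0 u, hpm]
        have hwl : Real.log |u| - Real.log 2 - q * |u|⁻¹ ≤ weilLevel |u| := by
          have e1 : 2 / |u| ^ 2 ≤ |u|⁻¹ := by
            rw [div_le_iff₀ (by positivity), sq, ← mul_assoc, inv_mul_cancel₀ hupos.ne', one_mul]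
            exact hu2
          have e2 : Real.pi / (2 * |u|) = Real.pi / 2 * |u|⁻¹ := by ring
          have e3 : weilLevel |u| =
              Real.log |u| - Real.log 2 - 2 / |u| ^ 2 - Real.pi / 2 * |u|⁻¹ := by
            rw [weilLevel, Real.log_div hupos.ne' two_ne_zero, e2]
          rw [e3, hq]
          linarith
        have hcl : 0 ≤ c - Real.log |u| := by linarith [hlogc u hu.le]
        have e1 : G u * (Real.log |u| - Real.log 2 - q * |u|⁻¹) ≤ G u * ρ u :=
          mul_le_mul_of_nonneg_left (hwl.trans hρu) (hG0 u)
        have e2 : κ * G u ≤ (c - Real.log 2) * G u := mul_le_mul_of_nonneg_right hκle (hG0 u)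
        have e3 : G u * (c - Real.log |u|) ≤ L ^ 2 * (c - Real.log |u|) :=
          mul_le_mul_of_nonneg_right hL2G hcl
        have e4 : G u * (q * |u|⁻¹) ≤ L ^ 2 * (q * |u|⁻¹) :=
          mul_le_mul_of_nonneg_right hL2G (by positivity)
        have e5 : L ^ 2 * ((c - Real.log |u|) + q * |u|⁻¹) ≤ L ^ 2 * k u :=
          mul_le_mul_of_nonneg_left hku (sq_nonneg L)
        simp only [hh]
        linarith
  -- Step 4: integrate the minorant
  have hkint : Integrable k := ((hi₀int.add hi₁int).add hipint).add himint
  have hkval : ∫ u, k u = 2 / b + 16.90981416 + 2 * (1 + Real.pi / 2) * (c - Real.log 2) := by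
    have ek : k = ((i₀ + i₁ + ip) + im) := by rw [hk]; rfl
    rw [ek, integral_add' ((hi₀int.add hi₁int).add hipint) himint,
      integral_add' (hi₀int.add hi₁int) hipint, integral_add' hi₀int hi₁int, hi₀val, hi₁val,
      hipval, himval, hq]
    ring
  have hGρi : Integrable fun u ↦ G u * ρ u :=
    integrable_norm_sq_weilMellin_mul_reDigammaQuarter hg
  have hhi : Integrable h := (hGi.const_mul κ).sub (hkint.const_mul (L ^ 2))
  have hhval : ∫ u, h u = κ * (2 * Real.pi * N) -
      L ^ 2 * (2 / b + 16.90981416 + 2 * (1 + Real.pi / 2) * (c - Real.log 2)) := by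
    simp only [hh]
    rw [integral_sub (hGi.const_mul _) (hkint.const_mul _), integral_const_mul,
      integral_const_mul, hPl, hkval]
  have hmono : ∫ u, h u ≤ A := integral_mono hhi hGρi hpt
  rw [hhval] at hmono
  rw [harch]
  exact closing_arith hb hb4 hN0 hc2 hκc (weilNorm1_sq_le hg hb hsupp) hmono

end Summit.RiemannHypothesis.RiemannHypothesis.Theorems.WeilCombBohrFejer

end
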